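import Summits.Ventures.PercRepro.C026KCut

/-!
# (CUT-INJ), counting form: `#Bad ≤ #GG` on every family closed under the K-cut map (mine-3 §45; gen 51)

From `card_notReach_le_card_good` (`#{Good₁ = 0} ≤ #{Good₂ = 1}` on a finite family of
configurations closed under `kcut`) by the four-type count: with `A = {Good₁ = 0}` and
`B = {Good₂ = 1}`, `Bad = A \ B` and `GG = B \ A`, and `#A ≤ #B` gives `#(A \ B) ≤ #(B \ A)`.
In the cut case `D₁ = {1}` this is conjecture (CUT-INJ) of MINE3-GLUING §43 (d) / §44 in its
counting form on every ≼-closed family (every such family is closed under the K-cut map, the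
image lying in the cluster cube of its argument), and the cut case of the certificate (CC) with
room: `2 #Bad ≤ 2 #GG ≤ 4 #GG + #SG`.
-/

namespace PercRepro

namespace MultiGraph

open Finset

variable {V E : Type*} {G : MultiGraph V E}

omit G in
/-- Two finite sets with `#A ≤ #B` satisfy `#(A \ B) ≤ #(B \ A)`. -/
theorem card_sdiff_le_card_sdiff_of_card_le {α : Type*} [DecidableEq α] {A B : Finset α}
    (h : A.card ≤ B.card) : (A \ B).card ≤ (B \ A).card := by
  have hA := card_sdiff_add_card_inter A B
  have hB := card_sdiff_add_card_inter B A
  rw [inter_comm] at hB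
  omega

open Classical in
/-- **(CUT-INJ), counting form.** On a finite family `𝒰` of configurations, each with `c ~ one`
and `one ∉ cluster Sᶜ t`, closed under the K-cut map on its members with «`c` does not reach `t`
avoiding `one`»: the Bad members («neither side good») are at most the GG members («both sides
good»):
`#{S ∈ 𝒰 : t ∉ K(S) ∧ ¬ c ⇝ one avoiding D(S)} ≤ #{S ∈ 𝒰 : t ∈ K(S) ∧ c ⇝ one avoiding D(S)}`. -/
theorem card_bad_le_card_gg {one c t : V} (hc : c ≠ one) (𝒰 : Finset (Config E))
    (hmem : ∀ S ∈ 𝒰, G.Conn S c one ∧ one ∉ G.cluster Sᶜ t)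
    (hclosed : ∀ S ∈ 𝒰, t ∉ G.redReach S one c → G.kcut S one c t ∈ 𝒰) :
    (𝒰.filter fun S => t ∉ G.redReach S one c ∧
        ¬ G.WalkAvoiding S (G.cluster Sᶜ t) c one).card ≤
      (𝒰.filter fun S => t ∈ G.redReach S one c ∧
        G.WalkAvoiding S (G.cluster Sᶜ t) c one).card := by
  have h := card_notReach_le_card_good (G := G) hc 𝒰 hmem hclosed
  have hBad : (𝒰.filter fun S => t ∉ G.redReach S one c ∧
      ¬ G.WalkAvoiding S (G.cluster Sᶜ t) c one) =
      (𝒰.filter fun S => t ∉ G.redReach S one c) \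
        (𝒰.filter fun S => G.WalkAvoiding S (G.cluster Sᶜ t) c one) := by
    ext S
    simp only [mem_filter, mem_sdiff, not_and]
    tauto
  have hGG : (𝒰.filter fun S => t ∈ G.redReach S one c ∧
      G.WalkAvoiding S (G.cluster Sᶜ t) c one) =
      (𝒰.filter fun S => G.WalkAvoiding S (G.cluster Sᶜ t) c one) \
        (𝒰.filter fun S => t ∉ G.redReach S one c) := by
    ext S
    simp only [mem_filter, mem_sdiff, not_and, not_not]
    tauto
  rw [hBad, hGG]
  exact card_sdiff_le_card_sdiff_of_card_le h

end MultiGraph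

end PercRepro
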